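import Literature.Probability.RandomPlanarGeometry.SLERestrictionAliveFn
import HarnessLib

/-!
# Control functionals of the slid hull along a driving path: clearance of a compact set, and `Φ'`

G. F. Lawler, O. Schramm, W. Werner, *Conformal restriction: the chordal case*, J. Amer. Math.
Soc. **16** (2003) 917–955 (**[LSW]**), §8.4: "`(M_t, t < T)` is a local martingale". Our
formalisation of Lemma 8.9 localises `M_t` along hitting times of CONTROLS of the slid hull
`B_t = A_t − W_t`: besides the alive functional `aliveFn` of the tree (`SLERestrictionAlive(Fn)`,
`≈ min_{s ≤ t} dist(0, B_s) ∧ 1`, continuous in `t` for every path, `= 0` from the hitting time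
`T_A` on) we need

* `Loewner.clearFn K` — **the clearance of a set `K`** (the real segment `[−R−3, 0]` in the
  application) **from the slid hull**: `inf_k dist(b_k(t), K)` over the dense slid points
  `b_k(t) = g_t(a_k) − W_t`; it is measurable in the path (countable infimum), bounds
  `dist(b, K)` from below for every `b ∈ B_t` at alive times (`clearFn_le_infDist`), and is
  continuous in `t` at alive times (`continuousWithinAt_clearFn`, by the two-sided tube
  `Loewner.exists_tube_at`: all slid points move by `≤ ε` uniformly);
* `Loewner.clearCtl c K = min clearFn (c · aliveFn)`, `Loewner.derivCtl c = min (Φ'_{B_t}(0)𝟙{alive}) (c · aliveFn)`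
  — **continuous modifications, for EVERY path and EVERY time** (at dead times they vanish with
  `aliveFn`, as the tree's `DhatFn`), measurable in the path; a level `0 < ℓ ≤ clearCtl` forces
  aliveness and the clearance of the balls `B(x, ℓ)`, `x ∈ K` (`clear_of_le_clearCtl`), a level
  `0 < ℓ ≤ derivCtl` forces `ℓ ≤ Φ'_{B_t}(0)` (`starDeriv_ge_of_le_derivCtl`).

Hitting times of closed sets by these continuous adapted processes are the stopping times of the
localisation (`Literature.Probability.Process.isStoppingTime_hittingAfter_of_continuous`).

No named facts.
-/

noncomputable section

open Set Filter Metric Function MeasureTheory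
open _root_.Complex _root_.Topology
open scoped NNReal

namespace Literature.Probability.RandomPlanarGeometry

namespace Loewner

variable {Ω : Type*} {W : Ω → ℝ≥0 → ℝ} {A K : Set ℂ} {t : ℝ≥0} {a : ℕ → ℂ} {ω : Ω}

/-! ### The clearance functional -/

/-- **Clearance of `K` from the slid hull** along the dense slid points:
`clearFn K a W t ω = inf_k dist(g_t(a_k) − W_t, K)`. [folklore] -/
def clearFn (K : Set ℂ) (a : ℕ → ℂ) (W : Ω → ℝ≥0 → ℝ) (t : ℝ≥0) (ω : Ω) : ℝ :=
  ⨅ k : ℕ, infDist (slidPt W a t k ω) K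

/-- The defining family is bounded below by `0`. [folklore] -/
theorem bddBelow_range_infDist_slidPt (K : Set ℂ) (a : ℕ → ℂ) (W : Ω → ℝ≥0 → ℝ) (t : ℝ≥0) (ω : Ω) :
    BddBelow (range fun k : ℕ ↦ infDist (slidPt W a t k ω) K) :=
  ⟨0, by rintro _ ⟨k, rfl⟩; exact infDist_nonneg⟩

/-- `0 ≤ clearFn`. [folklore] -/
theorem clearFn_nonneg (K : Set ℂ) (a : ℕ → ℂ) (W : Ω → ℝ≥0 → ℝ) (t : ℝ≥0) (ω : Ω) : 0 ≤ clearFn K a W t ω :=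
  le_ciInf fun _ ↦ infDist_nonneg

/-- `clearFn ≤ dist(b_k, K)` for every slid point. [folklore] -/
theorem clearFn_le_infDist_slidPt (K : Set ℂ) (a : ℕ → ℂ) (W : Ω → ℝ≥0 → ℝ) (t : ℝ≥0) (ω : Ω) (k : ℕ) :
    clearFn K a W t ω ≤ infDist (slidPt W a t k ω) K :=
  ciInf_le (bddBelow_range_infDist_slidPt K a W t ω) k

/-- **`clearFn ≤ dist(b, K)` for every point `b` of the slid hull** at an alive time (the slid points
are dense in the slid hull and `b ↦ dist(b, K)` is continuous). [folklore] -/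
theorem clearFn_le_infDist (hW : Continuous (W ω)) (hA : IsStarHull A)
    (hdense : A ⊆ closure (range a)) (halive : Disjoint (closedHull (W ω) t) A) {b : ℂ}
    (hb : b ∈ slidHull (W ω) A t) : clearFn K a W t ω ≤ infDist b K := by
  have hcl : IsClosed {z : ℂ | clearFn K a W t ω ≤ infDist z K} :=
    isClosed_le continuous_const (continuous_infDist_pt K)
  have hsub : range (fun k ↦ slidPt W a t k ω) ⊆ {z : ℂ | clearFn K a W t ω ≤ infDist z K} := by
    rintro _ ⟨k, rfl⟩; exact clearFn_le_infDist_slidPt K a W t ω k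
  exact closure_minimal hsub hcl (slidHull_subset_closure_range_slidPt hW hA hdense halive hb)

/-- **Clearance**: if `ℓ ≤ clearFn` at an alive time, the balls `B(x, ℓ)`, `x ∈ K`, miss the slid
hull. [folklore] -/
theorem disjoint_ball_of_le_clearFn (hW : Continuous (W ω)) (hA : IsStarHull A)
    (hdense : A ⊆ closure (range a)) (halive : Disjoint (closedHull (W ω) t) A) {ℓ : ℝ}
    (hℓ : ℓ ≤ clearFn K a W t ω) {x : ℂ} (hx : x ∈ K) : Disjoint (ball x ℓ) (slidHull (W ω) A t) := by
  rw [Set.disjoint_left]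
  intro b hbx hb
  have h1 := clearFn_le_infDist hW hA hdense halive hb (K := K)
  have h2 : infDist b K ≤ dist b x := infDist_le_dist_of_mem hx
  rw [mem_ball] at hbx
  linarith

/-! ### Measurability -/

section Measurable

variable {mΩ : MeasurableSpace Ω}

/-- **`clearFn` is measurable** (countable infimum of continuous functions of the measurable slid
points). [folklore] -/
theorem measurable_clearFn (hc : ∀ ω, Continuous (W ω)) (hmeas : ∀ s, s ≤ t → Measurable fun ω ↦ W ω s)
    (haH : ∀ k, 0 < (a k).im) : Measurable (clearFn K a W t) :=
  Measurable.iInf fun k ↦ (continuous_infDist_pt K).measurable.comp (measurable_slidPt hc hmeas haH k)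

end Measurable

/-! ### Continuity at alive times -/

/-- Infima of uniformly close families (bounded below) are close. [folklore] -/
theorem abs_ciInf_sub_ciInf_le {f g : ℕ → ℝ} (hf : BddBelow (range f)) (hg : BddBelow (range g)) {ε : ℝ}
    (h : ∀ k, |f k - g k| ≤ ε) : |(⨅ k, f k) - ⨅ k, g k| ≤ ε := by
  rw [abs_le]
  constructor
  · -- `⨅ g ≤ ⨅ f + ε`
    have : (⨅ k, g k) ≤ (⨅ k, f k) + ε := by
      refine (le_ciInf fun k ↦ ?_ : (⨅ k, g k) - ε ≤ ⨅ k, f k) |> fun h' ↦ by linarith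
      have := (abs_le.1 (h k)).1
      linarith [ciInf_le hg k]
    linarith
  · have : (⨅ k, f k) ≤ (⨅ k, g k) + ε := by
      refine (le_ciInf fun k ↦ ?_ : (⨅ k, f k) - ε ≤ ⨅ k, g k) |> fun h' ↦ by linarith
      have := (abs_le.1 (h k)).2
      linarith [ciInf_le hf k]
    linarith

/-- **`t ↦ clearFn_t` is continuous on the alive times** (two-sided tube: near an alive time all
slid points move uniformly little). [cite: LawlerSchrammWerner2003Restriction, §8.4 (localisation of M_t)] -/
theorem continuousWithinAt_clearFn (hW : Continuous (W ω)) (hA : IsStarHull A) (hne : A.Nonempty)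
    (ha : ∀ k, a k ∈ A) {s : ℝ≥0} (hs : Disjoint (closedHull (W ω) s) A) :
    ContinuousWithinAt (fun v : ℝ≥0 ↦ clearFn K a W v ω) {v | Disjoint (closedHull (W ω) v) A} s := by
  obtain ⟨ρ, -, -, htube⟩ := exists_tube_at hW hA hne hs
  rw [Metric.continuousWithinAt_iff]
  intro ε hε
  obtain ⟨δ, hδ, hδv⟩ := htube (ε / 2) (by positivity)
  refine ⟨δ, hδ, fun {v} hv hvs ↦ ?_⟩
  obtain ⟨hpt, -, -⟩ := hδv v hv (by rw [NNReal.dist_eq] at hvs; exact hvs.le)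
  rw [Real.dist_eq]
  have hk : ∀ k, |infDist (slidPt W a v k ω) K - infDist (slidPt W a s k ω) K| ≤ ε / 2 := by
    intro k
    have h1 := hpt (a k) (ha k)
    have hlip : |infDist (slidPt W a v k ω) K - infDist (slidPt W a s k ω) K| ≤ dist (slidPt W a v k ω) (slidPt W a s k ω) := by
      rw [abs_le]
      constructor
      · linarith [infDist_le_infDist_add_dist (s := K) (x := slidPt W a s k ω) (y := slidPt W a v k ω), dist_comm (slidPt W a v k ω) (slidPt W a s k ω)]
      · linarith [infDist_le_infDist_add_dist (s := K) (x := slidPt W a v k ω) (y := slidPt W a s k ω)]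
    refine hlip.trans ?_
    rw [dist_eq_norm]
    exact h1
  have := abs_ciInf_sub_ciInf_le (bddBelow_range_infDist_slidPt K a W v ω) (bddBelow_range_infDist_slidPt K a W s ω) hk
  exact lt_of_le_of_lt this (by linarith)

/-! ### The continuous modifications `clearCtl`, `derivCtl` -/

/-- **The clearance control** `min clearFn (c · aliveFn)`. [folklore] -/
def clearCtl (c : ℝ) (K : Set ℂ) (a : ℕ → ℂ) (W : Ω → ℝ≥0 → ℝ) (t : ℝ≥0) (ω : Ω) : ℝ :=
  min (clearFn K a W t ω) (c * aliveFn a W t ω)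

/-- **The derivative control** `min (Φ'_{B_t}(0) 𝟙{alive}) (c · aliveFn)` (the tree's `DhatFn` for a
general family of driving functions). [folklore] -/
def derivCtl (c : ℝ) (A : Set ℂ) (a : ℕ → ℂ) (W : Ω → ℝ≥0 → ℝ) (t : ℝ≥0) (ω : Ω) : ℝ :=
  min ({ω | Disjoint (closedHull (W ω) t) A}.indicator (fun ω ↦ starDeriv (slidHull (W ω) A t)) ω) (c * aliveFn a W t ω)

/-- `0 ≤ clearCtl ≤ c · aliveFn` for `c ≥ 0`. [folklore] -/
theorem clearCtl_nonneg_le {c : ℝ} (hc : 0 ≤ c) (t : ℝ≥0) (ω : Ω) :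
    0 ≤ clearCtl c K a W t ω ∧ clearCtl c K a W t ω ≤ c * aliveFn a W t ω :=
  ⟨le_min (clearFn_nonneg K a W t ω) (mul_nonneg hc (aliveFn_nonneg a W t ω)), min_le_right _ _⟩

/-- `0 ≤ derivCtl ≤ c · aliveFn` for `c ≥ 0`. [folklore] -/
theorem derivCtl_nonneg_le (hW : Continuous (W ω)) (hA : IsStarHull A) {c : ℝ} (hc : 0 ≤ c) (t : ℝ≥0) :
    0 ≤ derivCtl c A a W t ω ∧ derivCtl c A a W t ω ≤ c * aliveFn a W t ω := by
  refine ⟨le_min ?_ (mul_nonneg hc (aliveFn_nonneg a W t ω)), min_le_right _ _⟩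
  by_cases h : ω ∈ {ω | Disjoint (closedHull (W ω) t) A}
  · rw [Set.indicator_of_mem h]; exact (starDeriv_spec (isStarHull_slidHull_of_disjoint hW hA h)).1.le
  · rw [Set.indicator_of_notMem h]

section Measurable

variable {mΩ : MeasurableSpace Ω}

/-- `clearCtl` is measurable. [folklore] -/
theorem measurable_clearCtl (hc : ∀ ω, Continuous (W ω)) (hmeas : ∀ s, s ≤ t → Measurable fun ω ↦ W ω s)
    (haH : ∀ k, 0 < (a k).im) (c : ℝ) : Measurable (clearCtl c K a W t) :=
  (measurable_clearFn hc hmeas haH).min (measurable_const.mul (measurable_aliveFn hc hmeas haH))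

/-- `derivCtl` is measurable. [folklore] -/
theorem measurable_derivCtl (hc : ∀ ω, Continuous (W ω)) (hW0 : ∀ ω, W ω 0 = 0)
    (hmeas : ∀ s, s ≤ t → Measurable fun ω ↦ W ω s) (hA : IsStarHull A) (hne : A.Nonempty)
    (haH : ∀ k, 0 < (a k).im) (c : ℝ) : Measurable (derivCtl c A a W t) :=
  (measurable_indicator_starDeriv_slidHull hc hW0 hmeas hA hne).min (measurable_const.mul (measurable_aliveFn hc hmeas haH))

end Measurable

/-! ### Continuity for every path and every time -/

section Continuity

/-- A functional which is continuous on the alive times (within them), nonnegative, and dominated by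
`c · aliveFn` after taking `min`, has `min f (c · aliveFn)` continuous at every time. [folklore] -/
theorem continuous_min_mul_aliveFn (hW : Continuous (W ω)) (hW0 : W ω 0 = 0) (hA : IsStarHull A) (hne : A.Nonempty)
    (ha : ∀ k, a k ∈ A ∧ 0 < (a k).im) (hdense : A ⊆ closure (range a)) {f : ℝ≥0 → ℝ} (hf0 : ∀ v, 0 ≤ f v)
    (hf : ∀ s, Disjoint (closedHull (W ω) s) A → ContinuousWithinAt f {v | Disjoint (closedHull (W ω) v) A} s)
    {c : ℝ} (hc : 0 ≤ c) : Continuous fun t ↦ min (f t) (c * aliveFn a W t ω) := by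
  have hRc : Continuous fun t ↦ aliveFn a W t ω := continuous_aliveFn hW hW0 hA hne ha hdense
  refine continuous_iff_continuousAt.2 fun t₀ ↦ ?_
  by_cases h₀ : Disjoint (closedHull (W ω) t₀) A
  · -- alive: locally alive, `f` continuous there
    obtain ⟨t₁, ht₁, halive₁⟩ := exists_lt_disjoint hW hA h₀
    have hnhds : Iio t₁ ∈ 𝓝 t₀ := Iio_mem_nhds ht₁
    have hsub : Iio t₁ ⊆ {v | Disjoint (closedHull (W ω) v) A} := fun v hv ↦ alive_mono (le_of_lt hv) halive₁
    have hfc : ContinuousAt f t₀ := (hf t₀ h₀).continuousAt (Filter.mem_of_superset hnhds hsub)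
    exact (Filter.Tendsto.min hfc ((continuous_const.mul hRc).continuousAt) :)
  · -- dead: the value is `0` and `0 ≤ min ≤ c · aliveFn → 0`
    have hR0 : aliveFn a W t₀ ω = 0 := aliveFn_eq_zero_of_not_disjoint hW hW0 hA hdense (fun k ↦ (ha k).2) h₀
    have hv0 : min (f t₀) (c * aliveFn a W t₀ ω) = 0 := by
      rw [hR0, mul_zero]; exact min_eq_right (hf0 t₀)
    rw [ContinuousAt, hv0]
    have hup : Tendsto (fun t ↦ c * aliveFn a W t ω) (𝓝 t₀) (𝓝 0) := by
      have h1 : ContinuousAt (fun t ↦ c * aliveFn a W t ω) t₀ := (continuous_const.mul hRc).continuousAt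
      have h2 : c * aliveFn a W t₀ ω = 0 := by rw [hR0, mul_zero]
      rw [ContinuousAt, h2] at h1
      exact h1
    exact squeeze_zero (fun t ↦ le_min (hf0 t) (mul_nonneg hc (aliveFn_nonneg a W t ω))) (fun t ↦ min_le_right _ _) hup

/-- **`t ↦ clearCtl_t` is continuous for every path.** [folklore] -/
theorem continuous_clearCtl (hW : Continuous (W ω)) (hW0 : W ω 0 = 0) (hA : IsStarHull A) (hne : A.Nonempty)
    (ha : ∀ k, a k ∈ A ∧ 0 < (a k).im) (hdense : A ⊆ closure (range a)) {c : ℝ} (hc : 0 ≤ c) :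
    Continuous fun t ↦ clearCtl c K a W t ω :=
  continuous_min_mul_aliveFn hW hW0 hA hne ha hdense (fun v ↦ clearFn_nonneg K a W v ω)
    (fun _ hs ↦ continuousWithinAt_clearFn hW hA hne (fun k ↦ (ha k).1) hs) hc

/-- **`t ↦ derivCtl_t` is continuous for every path.** [folklore] -/
theorem continuous_derivCtl (hW : Continuous (W ω)) (hW0 : W ω 0 = 0) (hA : IsStarHull A) (hne : A.Nonempty)
    (ha : ∀ k, a k ∈ A ∧ 0 < (a k).im) (hdense : A ⊆ closure (range a)) {c : ℝ} (hc : 0 ≤ c) :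
    Continuous fun t ↦ derivCtl c A a W t ω := by
  refine continuous_min_mul_aliveFn hW hW0 hA hne ha hdense (f := fun v ↦
    {ω | Disjoint (closedHull (W ω) v) A}.indicator (fun ω ↦ starDeriv (slidHull (W ω) A v)) ω) (fun v ↦ ?_) (fun s hs ↦ ?_) hc
  · by_cases h : ω ∈ {ω | Disjoint (closedHull (W ω) v) A}
    · rw [Set.indicator_of_mem h]; exact (starDeriv_spec (isStarHull_slidHull_of_disjoint hW hA h)).1.le
    · rw [Set.indicator_of_notMem h]
  · have hd := continuousWithinAt_starDeriv_slidHull hW hA hne hs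
    refine (hd.congr (fun v hv ↦ ?_) ?_)
    · exact Set.indicator_of_mem (show ω ∈ {ω | Disjoint (closedHull (W ω) v) A} from hv) _
    · exact Set.indicator_of_mem (show ω ∈ {ω | Disjoint (closedHull (W ω) s) A} from hs) _

end Continuity

/-! ### What the levels control -/

/-- A positive level of `c · aliveFn` forces aliveness. [folklore] -/
theorem disjoint_of_mul_aliveFn_pos (hW : Continuous (W ω)) (hW0 : W ω 0 = 0) (hA : IsStarHull A) (hne : A.Nonempty)
    (ha : ∀ k, a k ∈ A ∧ 0 < (a k).im) (hdense : A ⊆ closure (range a)) {c ℓ : ℝ} (hc : 0 ≤ c) (hℓ : 0 < ℓ)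
    (h : ℓ ≤ c * aliveFn a W t ω) : Disjoint (closedHull (W ω) t) A := by
  have hpos : 0 < aliveFn a W t ω := by
    by_contra hle
    push Not at hle
    have : c * aliveFn a W t ω ≤ 0 := mul_nonpos_of_nonneg_of_nonpos hc hle
    linarith
  exact (disjoint_closedHull_iff_aliveFn_pos hW hW0 hA hne ha hdense).2 hpos

/-- **A level `0 < ℓ ≤ clearCtl` forces aliveness and the clearance of the balls `B(x, ℓ)`, `x ∈ K`.**
[folklore] -/
theorem clear_of_le_clearCtl (hW : Continuous (W ω)) (hW0 : W ω 0 = 0) (hA : IsStarHull A) (hne : A.Nonempty)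
    (ha : ∀ k, a k ∈ A ∧ 0 < (a k).im) (hdense : A ⊆ closure (range a)) {c ℓ : ℝ} (hc : 0 ≤ c) (hℓ : 0 < ℓ)
    (h : ℓ ≤ clearCtl c K a W t ω) :
    Disjoint (closedHull (W ω) t) A ∧ ∀ x ∈ K, Disjoint (ball x ℓ) (slidHull (W ω) A t) := by
  have halive := disjoint_of_mul_aliveFn_pos hW hW0 hA hne ha hdense hc hℓ (h.trans (min_le_right _ _))
  exact ⟨halive, fun x hx ↦ disjoint_ball_of_le_clearFn hW hA hdense halive (h.trans (min_le_left _ _)) hx⟩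

/-- **A level `0 < ℓ ≤ derivCtl` forces aliveness and `ℓ ≤ Φ'_{B_t}(0)`.** [folklore] -/
theorem starDeriv_ge_of_le_derivCtl (hW : Continuous (W ω)) (hW0 : W ω 0 = 0) (hA : IsStarHull A) (hne : A.Nonempty)
    (ha : ∀ k, a k ∈ A ∧ 0 < (a k).im) (hdense : A ⊆ closure (range a)) {c ℓ : ℝ} (hc : 0 ≤ c) (hℓ : 0 < ℓ)
    (h : ℓ ≤ derivCtl c A a W t ω) :
    Disjoint (closedHull (W ω) t) A ∧ ℓ ≤ starDeriv (slidHull (W ω) A t) := by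
  have halive := disjoint_of_mul_aliveFn_pos hW hW0 hA hne ha hdense hc hℓ (h.trans (min_le_right _ _))
  refine ⟨halive, ?_⟩
  have := h.trans (min_le_left _ _)
  rwa [Set.indicator_of_mem (show ω ∈ {ω | Disjoint (closedHull (W ω) t) A} from halive)] at this

/-- **A level `0 < ℓ ≤ c · aliveFn` (with `c ≥ 1`) forces the clearance of the ball `B(0, ℓ/c)` from
the slid hull** (`aliveFn ≤ dist(0, B_t) ∧ 1`). [folklore] -/
theorem disjoint_ball_zero_of_le_mul_aliveFn (hW : Continuous (W ω)) (hW0 : W ω 0 = 0) (hA : IsStarHull A)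
    (hne : A.Nonempty) (ha : ∀ k, a k ∈ A ∧ 0 < (a k).im) (hdense : A ⊆ closure (range a)) {c ℓ : ℝ}
    (hc : 0 < c) (hℓ : 0 < ℓ) (h : ℓ ≤ c * aliveFn a W t ω) :
    Disjoint (ball (0 : ℂ) (ℓ / c)) (slidHull (W ω) A t) := by
  have halive := disjoint_of_mul_aliveFn_pos hW hW0 hA hne ha hdense hc.le hℓ h
  have hR := aliveFn_le_min_infDist hW hA ha hdense le_rfl halive
  have hm : ℓ / c ≤ infDist 0 (slidHull (W ω) A t) := by
    rw [div_le_iff₀ hc]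
    calc ℓ ≤ c * aliveFn a W t ω := h
      _ ≤ c * infDist 0 (slidHull (W ω) A t) := by gcongr; exact hR.trans (min_le_left _ _)
      _ = infDist 0 (slidHull (W ω) A t) * c := mul_comm _ _
  exact disjoint_ball_infDist.mono_left (ball_subset_ball hm)

end Loewner

end Literature.Probability.RandomPlanarGeometry

end
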